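import Summits.AtomisticToContinuum.BoseEinsteinCondensation.Theorems.BECRieszReverseHolderCoarseGrainedReverseHolderStubRieszKernelOnsagerBound
import Literature.MathematicalPhysics.StatisticalMechanics.PeriodicRieszKernelFourier
import Literature.MathematicalPhysics.QuantumManyBody.PeriodicBoseGas
import HarnessLib

/-!
# The heat-smoothed density fluctuation is dominated by the Riesz energy
(route BECRieszReverseHolder)

Line `registered` of crux stmt-AtomisticToContinuum-12840 `CoarseGrainedReverseHolder`; registered
sub-goal `stub_heatSumLeRieszEnergy` (S4′A), the pointwise half of the classical engine in variance
form.

For the smeared zero-mean periodic Riesz-2 kernel `g = periodicRieszKernel 2 L η` (heat-kernel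
subordination `g(x) = K₂ ∫_{t > η²} t^{(1-2)/2} Θ_{L,t}(x) dt`, `Θ_{L,t} = periodicHeatSum L t`,
`K₂ = rieszSubordinationConst 2`) and the heat-smoothed density fluctuation
`D_t(X) = Σ_{i,j} Θ_{L,t}(X_i − X_j)` (diagonal included) one has, for `0 < η`, `η² < t₀` and every
configuration `X`,

  `2 K₂ (√t₀ − η) D_{t₀}(X) ≤ Σ_{i,j} g(X_i − X_j)`.

Proof. `Σ_{i,j} g(X_i − X_j) = K₂ ∫_{(η²,∞)} t^{-1/2} D_t(X) dt` (finite sums commute with the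
convergent integral, `sum_sum_mul_periodicRieszKernel_eq`); `D_t ≥ 0` for every `t > 0`
(`sum_sum_mul_periodicHeatSum_nonneg'`: the subtracted cell average is the zero Fourier mode of the
torus heat kernel), so the integral over `(η², ∞)` dominates the integral over `(η², t₀]`;
`t ↦ D_t` is non-increasing (on the Fourier side `D_t = L⁻³ Σ_k e^{-4π²|k|²t/L²} |Σ_i e_k(X_i/L)|²
− L⁻³ n²` and each heat coefficient decreases in `t`), so on `(η², t₀]` the integrand is at least
`t^{-1/2} D_{t₀}`; finally `∫_{η²}^{t₀} t^{-1/2} dt = 2(√t₀ − η)`.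
-/

namespace Summit.AtomisticToContinuum.BoseEinsteinCondensation.Theorems.CoarseGrainedReverseHolder

open MeasureTheory Set Filter Real UnitAddTorus
open Literature.Analysis.FunctionSpaces
open Literature.MathematicalPhysics.QuantumManyBody Literature.MathematicalPhysics.StatisticalMechanics

/-! ## Monotonicity in time of the heat-smoothed quadratic forms -/

/-- **Fourier expansion of the torus heat-kernel quadratic form**: for `τ > 0`, points `y_i ∈ T^d`
and real weights `c_i`,
`Σ_{i,j} c_i c_j p_τ(y_i − y_j) = Σ_k e^{-4π²|k|²τ} |Σ_i c_i e^{2πik·y_i}|²` (as a `HasSum`). -/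
theorem hasSum_heatCoeff_mul_norm_sq {d : Type*} [Fintype d] {τ : ℝ} (hτ : 0 < τ) {m : ℕ}
    (y : Fin m → UnitAddTorus d) (c : Fin m → ℝ) :
    HasSum (fun k : d → ℤ => Torus.heatCoeff τ k * ‖∑ i, (c i : ℂ) * mFourier k (y i)‖ ^ 2)
      (∑ i, ∑ j, c i * c j * Torus.heatKernel τ (y i - y j)) := by
  classical
  -- adapted from `sq_sum_le_sum_sum_mul_torusHeatKernel` (Theorems/…StubRieszKernelOnsagerBound)
  set A : (d → ℤ) → ℂ := fun k => ∑ i, (c i : ℂ) * mFourier k (y i) with hA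
  have hpair : ∀ i j, HasSum (fun k : d → ℤ => (c i : ℂ) * mFourier k (y i) *
      ((starRingEnd ℂ) ((c j : ℂ) * mFourier k (y j))) * ((Torus.heatCoeff τ k : ℝ) : ℂ))
      ((c i : ℂ) * (c j : ℂ) * Torus.heatKernelC τ (y i - y j)) := by
    intro i j
    refine ((Torus.hasSum_heatKernelC hτ (y i - y j)).mul_left ((c i : ℂ) * (c j : ℂ))).congr_fun
      fun k => ?_
    rw [sub_eq_add_neg, Torus.mFourier_apply_add, mFourier_apply_neg, map_mul, Complex.conj_ofReal,
      smul_eq_mul]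
    ring
  have hsum : HasSum (fun k : d → ℤ => ∑ i, ∑ j, (c i : ℂ) * mFourier k (y i) *
      ((starRingEnd ℂ) ((c j : ℂ) * mFourier k (y j))) * ((Torus.heatCoeff τ k : ℝ) : ℂ))
      (∑ i, ∑ j, (c i : ℂ) * (c j : ℂ) * Torus.heatKernelC τ (y i - y j)) :=
    hasSum_sum fun i _ => hasSum_sum fun j _ => hpair i j
  have hterm : ∀ k : d → ℤ, ∑ i, ∑ j, (c i : ℂ) * mFourier k (y i) *
      ((starRingEnd ℂ) ((c j : ℂ) * mFourier k (y j))) * ((Torus.heatCoeff τ k : ℝ) : ℂ) =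
      ((Torus.heatCoeff τ k * ‖A k‖ ^ 2 : ℝ) : ℂ) := by
    intro k
    rw [Complex.ofReal_mul, Complex.ofReal_pow, ← Complex.mul_conj', hA, map_sum, Finset.sum_mul_sum,
      Finset.mul_sum]
    refine Finset.sum_congr rfl fun i _ => ?_
    rw [Finset.mul_sum]
    refine Finset.sum_congr rfl fun j _ => ?_
    ring
  have hval : ∑ i, ∑ j, (c i : ℂ) * (c j : ℂ) * Torus.heatKernelC τ (y i - y j) =
      ((∑ i, ∑ j, c i * c j * Torus.heatKernel τ (y i - y j) : ℝ) : ℂ) := by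
    push_cast
    refine Finset.sum_congr rfl fun i _ => Finset.sum_congr rfl fun j _ => ?_
    rw [Torus.ofReal_heatKernel hτ]
  have hsum' : HasSum (fun k : d → ℤ => ((Torus.heatCoeff τ k * ‖A k‖ ^ 2 : ℝ) : ℂ))
      (((∑ i, ∑ j, c i * c j * Torus.heatKernel τ (y i - y j) : ℝ) : ℂ)) := by
    rw [← hval]
    refine hsum.congr_fun fun k => ?_
    simp only [hterm]
  exact Complex.hasSum_ofReal.1 hsum'

/-- **The torus heat-kernel quadratic form is non-increasing in time**: for `0 < τ ≤ τ'`,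
`Σ_{i,j} c_i c_j p_{τ'}(y_i − y_j) ≤ Σ_{i,j} c_i c_j p_τ(y_i − y_j)` (each heat coefficient
`e^{-4π²|k|²τ}` decreases in `τ`). -/
theorem sum_sum_mul_torusHeatKernel_le_of_le {d : Type*} [Fintype d] {τ τ' : ℝ} (hτ : 0 < τ)
    (h : τ ≤ τ') {m : ℕ} (y : Fin m → UnitAddTorus d) (c : Fin m → ℝ) :
    ∑ i, ∑ j, c i * c j * Torus.heatKernel τ' (y i - y j) ≤
      ∑ i, ∑ j, c i * c j * Torus.heatKernel τ (y i - y j) :=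
  hasSum_le (fun k => mul_le_mul_of_nonneg_right (Torus.heatCoeff_le_of_le h k) (sq_nonneg _))
    (hasSum_heatCoeff_mul_norm_sq (hτ.trans_le h) y c) (hasSum_heatCoeff_mul_norm_sq hτ y c)

/-- **The `Θ_{L,t}` quadratic form is non-increasing in time**: for `0 < L`, `0 < t ≤ t'` and all
real weights, `Σ_{i,j} c_i c_j Θ_{L,t'}(z_i − z_j) ≤ Σ_{i,j} c_i c_j Θ_{L,t}(z_i − z_j)`. -/
theorem sum_sum_mul_periodicHeatSum_le_of_le {L t t' : ℝ} (hL : 0 < L) (ht : 0 < t) (h : t ≤ t')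
    {m : ℕ} (z : Fin m → EuclideanSpace ℝ (Fin 3)) (c : Fin m → ℝ) :
    ∑ i, ∑ j, c i * c j * periodicHeatSum L t' (z i - z j) ≤
      ∑ i, ∑ j, c i * c j * periodicHeatSum L t (z i - z j) := by
  have ht' : 0 < t' := ht.trans_le h
  rw [sum_sum_mul_periodicHeatSum_eq hL ht, sum_sum_mul_periodicHeatSum_eq hL ht']
  refine sub_le_sub_right (mul_le_mul_of_nonneg_left ?_ (by positivity)) _
  exact sum_sum_mul_torusHeatKernel_le_of_le (by positivity)
    (div_le_div_of_nonneg_right h (by positivity)) _ c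

/-- Unit-weight specialisation: `D_{t'}(X) ≤ D_t(X)` for `0 < t ≤ t'`, where
`D_t(X) = Σ_{i,j} Θ_{L,t}(X_i − X_j)`. -/
theorem sum_sum_periodicHeatSum_le_of_le {L t t' : ℝ} (hL : 0 < L) (ht : 0 < t) (h : t ≤ t')
    {m : ℕ} (z : Fin m → EuclideanSpace ℝ (Fin 3)) :
    ∑ i, ∑ j, periodicHeatSum L t' (z i - z j) ≤ ∑ i, ∑ j, periodicHeatSum L t (z i - z j) := by
  have h1 := sum_sum_mul_periodicHeatSum_le_of_le hL ht h z (fun _ => (1 : ℝ))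
  simpa only [one_mul] using h1

/-- Unit-weight specialisation of positive type: `0 ≤ D_t(X)` for `0 < L`, `0 < t`. -/
theorem sum_sum_periodicHeatSum_nonneg {L t : ℝ} (hL : 0 < L) (ht : 0 < t) {m : ℕ}
    (z : Fin m → EuclideanSpace ℝ (Fin 3)) :
    0 ≤ ∑ i, ∑ j, periodicHeatSum L t (z i - z j) := by
  have h1 := sum_sum_mul_periodicHeatSum_nonneg' hL ht z (fun _ => (1 : ℝ))
  simpa only [one_mul] using h1

/-- Unit-weight specialisation of the subordination identity:
`Σ_{i,j} g(z_i − z_j) = K_s ∫_{(η²,∞)} t^{(1-s)/2} D_t dt`. -/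
theorem sum_sum_periodicRieszKernel_eq {s L η : ℝ} (hL : 0 < L) (hη : η ≠ 0) {m : ℕ}
    (z : Fin m → EuclideanSpace ℝ (Fin 3)) :
    ∑ i, ∑ j, periodicRieszKernel s L η (z i - z j) =
      rieszSubordinationConst s * ∫ t in Ioi (η ^ 2),
        t ^ ((1 - s) / 2) * ∑ i, ∑ j, periodicHeatSum L t (z i - z j) := by
  have h1 := sum_sum_mul_periodicRieszKernel_eq (s := s) hL hη z (fun _ => (1 : ℝ))
  simpa only [one_mul] using h1

/-- The subordination integrand of the density fluctuation, `t ↦ t^a D_t(X)`, is integrable on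
`(η², ∞)` for `η ≠ 0` (finite sum of integrable functions). -/
theorem integrableOn_rpow_mul_sum_sum_periodicHeatSum {L η : ℝ} (hL : 0 < L) (hη : η ≠ 0) (a : ℝ)
    {m : ℕ} (z : Fin m → EuclideanSpace ℝ (Fin 3)) :
    IntegrableOn (fun t : ℝ => t ^ a * ∑ i, ∑ j, periodicHeatSum L t (z i - z j)) (Ioi (η ^ 2)) := by
  have h : (fun t : ℝ => t ^ a * ∑ i, ∑ j, periodicHeatSum L t (z i - z j)) =
      fun t : ℝ => ∑ i, ∑ j, t ^ a * periodicHeatSum L t (z i - z j) := by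
    funext t
    simp only [Finset.mul_sum]
  rw [h]
  exact integrable_finsetSum _ fun i _ => integrable_finsetSum _ fun j _ =>
    integrableOn_rpow_mul_periodicHeatSum hL hη a (z i - z j)

/-- `∫_{η²}^{t₀} t^{(1-2)/2} dt = 2(√t₀ − η)` for `0 < η`, `η² ≤ t₀`. -/
theorem integral_Ioc_rpow_neg_half {η t₀ : ℝ} (hη : 0 < η) (h : η ^ 2 ≤ t₀) :
    ∫ t in Ioc (η ^ 2) t₀, t ^ ((1 - 2) / 2 : ℝ) = 2 * (Real.sqrt t₀ - η) := by
  have hη2 : 0 < η ^ 2 := by positivity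
  have h0 : (0 : ℝ) ∉ uIcc (η ^ 2) t₀ := by
    rw [uIcc_of_le h]
    exact fun hx => (lt_irrefl (0 : ℝ)) (hη2.trans_le hx.1)
  rw [← intervalIntegral.integral_of_le h, integral_rpow (Or.inr ⟨by norm_num, h0⟩)]
  have ha : ((1 - 2) / 2 : ℝ) + 1 = 1 / 2 := by norm_num
  rw [ha, ← Real.sqrt_eq_rpow, ← Real.sqrt_eq_rpow, Real.sqrt_sq hη.le]
  ring

/-! ## The stub -/

/-- **S4′A — the heat-smoothed density fluctuation is dominated by the Riesz energy.** For
`0 < L`, `0 < η`, `η² < t₀` and every configuration `X ∈ (ℝ³)ⁿ`: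
`2 K₂ (√t₀ − η) · Σ_{i,j} Θ_{L,t₀}(X_i − X_j) ≤ Σ_{i,j} g(X_i − X_j)` with
`g = periodicRieszKernel 2 L η`, `K₂ = rieszSubordinationConst 2`: subordination identity,
`D_t ≥ 0`, `t ↦ D_t` non-increasing, and `∫_{η²}^{t₀} t^{-1/2} dt = 2(√t₀ − η)`. -/
theorem stub_heatSumLeRieszEnergy : ∀ (n : ℕ) (L η t₀ : ℝ), 0 < L → 0 < η → η ^ 2 < t₀ → ∀ X : BoseGas.Config n, 2 * rieszSubordinationConst 2 * (Real.sqrt t₀ - η) * ∑ i : Fin n, ∑ j : Fin n, periodicHeatSum L t₀ (X i - X j) ≤ ∑ i : Fin n, ∑ j : Fin n, periodicRieszKernel 2 L η (X i - X j) := by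
  intro n L η t₀ hL hη ht₀ X
  have hη0 : η ≠ 0 := hη.ne'
  have hη2 : 0 < η ^ 2 := by positivity
  have ht₀0 : 0 < t₀ := hη2.trans ht₀
  have hK : 0 < rieszSubordinationConst 2 := rieszSubordinationConst_pos two_pos
  set D : ℝ → ℝ := fun t => ∑ i : Fin n, ∑ j : Fin n, periodicHeatSum L t (X i - X j) with hD
  have hDnn : ∀ t, 0 < t → 0 ≤ D t := fun t ht => sum_sum_periodicHeatSum_nonneg hL ht X
  have hDle : ∀ t, 0 < t → t ≤ t₀ → D t₀ ≤ D t := fun t ht h => sum_sum_periodicHeatSum_le_of_le hL ht h X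
  have hint : IntegrableOn (fun t : ℝ => t ^ ((1 - 2) / 2 : ℝ) * D t) (Ioi (η ^ 2)) :=
    integrableOn_rpow_mul_sum_sum_periodicHeatSum hL hη0 _ X
  -- (4a) restrict the subordination integral to `(η², t₀]`
  have h1 : ∫ t in Ioc (η ^ 2) t₀, t ^ ((1 - 2) / 2 : ℝ) * D t ≤
      ∫ t in Ioi (η ^ 2), t ^ ((1 - 2) / 2 : ℝ) * D t := by
    refine setIntegral_mono_set hint ?_ Ioc_subset_Ioi_self.eventuallyLE
    refine (ae_restrict_iff' measurableSet_Ioi).2 (Eventually.of_forall fun t hmem => ?_)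
    have ht : 0 < t := hη2.trans hmem
    exact mul_nonneg (Real.rpow_nonneg ht.le _) (hDnn t ht)
  -- (4b) on `(η², t₀]` the integrand dominates `t^{-1/2} D_{t₀}`
  have h2 : ∫ t in Ioc (η ^ 2) t₀, t ^ ((1 - 2) / 2 : ℝ) * D t₀ ≤
      ∫ t in Ioc (η ^ 2) t₀, t ^ ((1 - 2) / 2 : ℝ) * D t := by
    refine integral_mono_of_nonneg ?_ (hint.mono_set Ioc_subset_Ioi_self) ?_
    · refine (ae_restrict_iff' measurableSet_Ioc).2 (Eventually.of_forall fun t hmem => ?_)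
      have ht : 0 < t := hη2.trans hmem.1
      exact mul_nonneg (Real.rpow_nonneg ht.le _) (hDnn t₀ ht₀0)
    · refine (ae_restrict_iff' measurableSet_Ioc).2 (Eventually.of_forall fun t hmem => ?_)
      have ht : 0 < t := hη2.trans hmem.1
      exact mul_le_mul_of_nonneg_left (hDle t ht hmem.2) (Real.rpow_nonneg ht.le _)
  -- (4c) the lower integral in closed form
  have h3 : ∫ t in Ioc (η ^ 2) t₀, t ^ ((1 - 2) / 2 : ℝ) * D t₀ = 2 * (Real.sqrt t₀ - η) * D t₀ := by
    rw [integral_mul_const, integral_Ioc_rpow_neg_half hη ht₀.le]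
  have h4 : 2 * (Real.sqrt t₀ - η) * D t₀ ≤ ∫ t in Ioi (η ^ 2), t ^ ((1 - 2) / 2 : ℝ) * D t :=
    h3 ▸ h2.trans h1
  rw [sum_sum_periodicRieszKernel_eq hL hη0 X]
  calc 2 * rieszSubordinationConst 2 * (Real.sqrt t₀ - η) * D t₀
      = rieszSubordinationConst 2 * (2 * (Real.sqrt t₀ - η) * D t₀) := by ring
    _ ≤ rieszSubordinationConst 2 * ∫ t in Ioi (η ^ 2), t ^ ((1 - 2) / 2 : ℝ) * D t :=
        mul_le_mul_of_nonneg_left h4 hK.le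

end Summit.AtomisticToContinuum.BoseEinsteinCondensation.Theorems.CoarseGrainedReverseHolder
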